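import Summits.HubbardSuperconductivity.HubbardSuperconductivity.Theorems.MesoscopicPairOrder.Negative.PolarisedExclusion
import HarnessLib

/-!
# Crux `MesoscopicPairOrder` (item `stmt-HubbardSuperconductivity-7331`), line `redirect_birth`, stub (Q)
# `stub_pairFluctuationFloor`: typed POSITION of the fixed-scale floor (refuter instrument + necessity)

Wave 1 of lead c9 (stub-worker audit of (Q), landed by the lead); the stub itself is OPEN and is NOT proved or refuted here.
Stub (Q) asks, at EVERY point of the box `U ∈ (0,6]`, `δ ∈ [1/10,3/10]` and every fixed block scale
`R ≥ 1`, a floor `c(U,δ,R) ≤ T_R(ψ)/L²` on the Fejér-box `d`-wave pair functional of every normalised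
`(N_L, S^z = 0)`-sector ground state of `hubbardTorus 2 L 1 U`, eventually in even `L`. This file records
the (Q)-specific forms of the two `PolarisedExclusion` instruments (there stated for the crux body
`∃ m ∀ R₀ ∃ R ≥ R₀ …`; (Q)'s body has a FIXED scale and an `R`-dependent constant, so neither is a
syntactic instance of the other):

* `fluctuationFloorAt_false_of_nearlySaturated` — REFUTER INSTRUMENT: if at `(U, δ)` nearly saturated
  sector ground states occur along infinitely many even sides (spin deficiency `n - S ≤ κ L²` for every
  `κ > 0`), then the body of (Q) fails at `(U, δ)` at EVERY scale `R ≥ 1`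
  (`T_R ≤ 100 R² (n - S)`, `boxSum_le_hundred_mul_spinDeficiency`). One such point in the box kills (Q).
* `spinDeficiency_ge_of_fluctuationFloorAt` — NECESSITY: the body of (Q) at `(U, δ, R)` with constant
  `c` forces `c L² ≤ 100 R² (n - S)` for every `S²`-diagonal sector ground state of every large even
  torus: an EXTENSIVE spin deficiency everywhere on the box is necessary for (Q).
* `localWeight_ge_of_fluctuationFloorAt` — NECESSITY / weakest instance: the body of (Q) at `(U, δ, R)`
  forces the local `d`-wave pair weight floor `c/R² ≤ L⁻² Σ_x ‖P_x ψ‖²` (`boxSum_le_sq_mul_localWeight`),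
  i.e. (Q) at any scale contains (Q) at the nearest-neighbour scale.

Neither hypothesis (near-saturation i.o.; extensive spin deficiency) is decided at any point of the box
by anything in the tree: `Negative/NoSaturationEnvelope` excludes only FULL saturation i.o. (single spin
flip, an `O(1)` energy gain). Sources: H. Tasaki, Prog. Theor. Phys. 99 (1998) 489, pp. 20–21;
E. H. Lieb, PRL 62 (1989) 1201; D. J. Scalapino, Phys. Rep. 250 (1995) 329, §2. Folklore; no
definition, no named fact, no sorry.
-/

noncomputable section

-- the summit namespace repeats the problem name by design (D-0017)
set_option linter.dupNamespace false

namespace Summit.HubbardSuperconductivity.HubbardSuperconductivity.Theorems.MesoscopicPairOrder.Negative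

open Matrix Finset Filter
open Literature.Probability.LatticeModels Literature.MathematicalPhysics.QuantumLattice
open scoped ComplexOrder ComplexConjugate

/-- **Refuter instrument for stub (Q).** If at `(U, δ)`, for every `κ > 0`, infinitely many even sides
`L` carry a ground state `ψ` of the `(2n, S^z = 0)` sector (`n = ⌊(1-δ)L²/2⌋`) of `hubbardTorus 2 L 1 U`
with `S² ψ = S(S+1) ψ`, `S ≤ n` and `n - S ≤ κ L²`, then at every fixed scale `R ≥ 1` no floor `c > 0`
on `T_R(ψ)/L²` holds eventually over all normalised sector ground states: with `κ = c/(200 R²)` the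
normalised nearly saturated ground state has `c L² ≤ T_R ≤ 100 R² (n - S) ≤ (c/2) L²`.
Tasaki, Prog. Theor. Phys. 99 (1998) 489, p. 20; Lieb, PRL 62 (1989) 1201. [folklore] -/
theorem fluctuationFloorAt_false_of_nearlySaturated {U δ : ℝ}
    (hns : ∀ κ : ℝ, 0 < κ → ∃ᶠ L : ℕ in atTop, Even L ∧
      ∃ (ψ : Fock (Orb (FermionTorus 2 L))) (S : ℕ), S ≤ ⌊(1 - δ) * (L : ℝ) ^ 2 / 2⌋₊ ∧
        IsGroundStateInSector (hubbardTorus 2 L 1 U) (2 * ⌊(1 - δ) * (L : ℝ) ^ 2 / 2⌋₊) 0 ψ ∧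
          spinSq *ᵥ ψ = (((S : ℝ) * ((S : ℝ) + 1) : ℝ) : ℂ) • ψ ∧
            ((⌊(1 - δ) * (L : ℝ) ^ 2 / 2⌋₊ - S : ℕ) : ℝ) ≤ κ * (L : ℝ) ^ 2)
    (R : ℕ) (hR : 0 < R) :
    ¬ ∃ c : ℝ, 0 < c ∧ ∃ L₀ : ℕ, ∀ (L : ℕ) [NeZero L], L₀ ≤ L → Even L →
        ∀ ψ : Fock (Orb (FermionTorus 2 L)), star ψ ⬝ᵥ ψ = 1 →
          IsGroundStateInSector (hubbardTorus 2 L 1 U) (2 * ⌊(1 - δ) * (L : ℝ) ^ 2 / 2⌋₊) 0 ψ →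
            c ≤ (∑ x : TorusSite 2 L, ∑ y : TorusSite 2 L,
                  (∏ i : Fin 2, max 0 (1 - |(((y i - x i).valMinAbs : ℤ) : ℝ)| / (R : ℝ))) *
                    (star (localPair dWaveFormFactor L x *ᵥ ψ) ⬝ᵥ (localPair dWaveFormFactor L y *ᵥ ψ)).re) /
                (L : ℝ) ^ 2 := by
  rintro ⟨c, hc, L₀, hL⟩
  have hRpos : (0 : ℝ) < R := Nat.cast_pos.2 hR
  have hR2 : (0 : ℝ) < (R : ℝ) ^ 2 := by positivity
  obtain ⟨L, ⟨hEven, ψ, S, hS, hgs, hspin, hdef⟩, hLge⟩ :=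
    ((hns (c / (200 * (R : ℝ) ^ 2)) (by positivity)).and_eventually
      (eventually_ge_atTop (max L₀ (2 * R)))).exists
  have hL0 : L₀ ≤ L := le_of_max_le_left hLge
  have h2R : 2 * R ≤ L := le_of_max_le_right hLge
  haveI : NeZero L := ⟨by omega⟩
  obtain ⟨φ, hφ1, hφgs, hT⟩ := exists_unit_groundState_boxSum_le (U := U) R hR h2R hS hgs hspin
  have hbad := hL L hL0 hEven φ hφ1 hφgs
  have hLpos : (0 : ℝ) < L := Nat.cast_pos.2 (Nat.pos_of_ne_zero (NeZero.ne L))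
  have hL2 : (0 : ℝ) < (L : ℝ) ^ 2 := by positivity
  rw [le_div_iff₀ hL2] at hbad
  -- `c L² ≤ T_R(φ) ≤ 100 R² (n - S) ≤ 100 R² · (c/(200 R²)) L² = (c/2) L²`
  have h1 : c * (L : ℝ) ^ 2 ≤ 100 * (R : ℝ) ^ 2 * (c / (200 * (R : ℝ) ^ 2) * (L : ℝ) ^ 2) :=
    hbad.trans (hT.trans (mul_le_mul_of_nonneg_left hdef (by positivity)))
  have h2 : 100 * (R : ℝ) ^ 2 * (c / (200 * (R : ℝ) ^ 2) * (L : ℝ) ^ 2) = c / 2 * (L : ℝ) ^ 2 := by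
    field_simp
    ring
  rw [h2] at h1
  nlinarith [mul_pos hc hL2]

/-- **Necessity for stub (Q): extensive spin deficiency.** If the body of (Q) holds at `(U, δ)` at the
scale `R ≥ 1` with constant `c`, then for all large even `L` every ground state `ψ` of the
`(2n, S^z = 0)` sector (`n = ⌊(1-δ)L²/2⌋`) of `hubbardTorus 2 L 1 U` with `S² ψ = S(S+1) ψ`, `S ≤ n`, has
`c L² ≤ 100 R² (n - S)` (normalise `ψ`, apply the floor and `boxSum_le_hundred_mul_spinDeficiency`).
Since `[H, S²] = 0` the sector ground eigenspace is spanned by such `ψ`.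
Tasaki, Prog. Theor. Phys. 99 (1998) 489, p. 20; Lieb, PRL 62 (1989) 1201. [folklore] -/
theorem spinDeficiency_ge_of_fluctuationFloorAt {U δ : ℝ} {R : ℕ} (hR : 0 < R) {c : ℝ}
    (h : ∃ L₀ : ℕ, ∀ (L : ℕ) [NeZero L], L₀ ≤ L → Even L →
        ∀ ψ : Fock (Orb (FermionTorus 2 L)), star ψ ⬝ᵥ ψ = 1 →
          IsGroundStateInSector (hubbardTorus 2 L 1 U) (2 * ⌊(1 - δ) * (L : ℝ) ^ 2 / 2⌋₊) 0 ψ →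
            c ≤ (∑ x : TorusSite 2 L, ∑ y : TorusSite 2 L,
                  (∏ i : Fin 2, max 0 (1 - |(((y i - x i).valMinAbs : ℤ) : ℝ)| / (R : ℝ))) *
                    (star (localPair dWaveFormFactor L x *ᵥ ψ) ⬝ᵥ (localPair dWaveFormFactor L y *ᵥ ψ)).re) /
                (L : ℝ) ^ 2) :
    ∃ L₀ : ℕ, ∀ (L : ℕ) [NeZero L], L₀ ≤ L → Even L →
      ∀ ψ : Fock (Orb (FermionTorus 2 L)),
        IsGroundStateInSector (hubbardTorus 2 L 1 U) (2 * ⌊(1 - δ) * (L : ℝ) ^ 2 / 2⌋₊) 0 ψ →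
          ∀ S : ℕ, S ≤ ⌊(1 - δ) * (L : ℝ) ^ 2 / 2⌋₊ →
            spinSq *ᵥ ψ = (((S : ℝ) * ((S : ℝ) + 1) : ℝ) : ℂ) • ψ →
              c * (L : ℝ) ^ 2 ≤ 100 * (R : ℝ) ^ 2 * ((⌊(1 - δ) * (L : ℝ) ^ 2 / 2⌋₊ - S : ℕ) : ℝ) := by
  obtain ⟨L₀, hL⟩ := h
  refine ⟨max L₀ (2 * R), fun L _ hLge hEven ψ hgs S hS hspin => ?_⟩
  have hL0 : L₀ ≤ L := le_of_max_le_left hLge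
  have h2R : 2 * R ≤ L := le_of_max_le_right hLge
  obtain ⟨φ, hφ1, hφgs, hT⟩ := exists_unit_groundState_boxSum_le (U := U) R hR h2R hS hgs hspin
  have hgood := hL L hL0 hEven φ hφ1 hφgs
  have hLpos : (0 : ℝ) < L := Nat.cast_pos.2 (Nat.pos_of_ne_zero (NeZero.ne L))
  have hL2 : (0 : ℝ) < (L : ℝ) ^ 2 := by positivity
  rw [le_div_iff₀ hL2] at hgood
  exact hgood.trans hT

/-- **Necessity for stub (Q): the nearest-neighbour scale is the weakest instance.** If the body of (Q)
holds at `(U, δ)` at the scale `R ≥ 1` with constant `c`, then eventually in even `L` every normalised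
sector ground state has local `d`-wave pair weight `c/R² ≤ L⁻² Σ_x ‖P_x ψ‖²`
(`T_R(ψ) ≤ R² Σ_x ‖P_x ψ‖²`, `boxSum_le_sq_mul_localWeight`). Scalapino, Phys. Rep. 250 (1995) 329, §2;
Kennedy–Lieb–Shastry, PRL 61 (1988) 2582. [folklore] -/
theorem localWeight_ge_of_fluctuationFloorAt {U δ : ℝ} {R : ℕ} (hR : 0 < R) {c : ℝ}
    (h : ∃ L₀ : ℕ, ∀ (L : ℕ) [NeZero L], L₀ ≤ L → Even L →
        ∀ ψ : Fock (Orb (FermionTorus 2 L)), star ψ ⬝ᵥ ψ = 1 →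
          IsGroundStateInSector (hubbardTorus 2 L 1 U) (2 * ⌊(1 - δ) * (L : ℝ) ^ 2 / 2⌋₊) 0 ψ →
            c ≤ (∑ x : TorusSite 2 L, ∑ y : TorusSite 2 L,
                  (∏ i : Fin 2, max 0 (1 - |(((y i - x i).valMinAbs : ℤ) : ℝ)| / (R : ℝ))) *
                    (star (localPair dWaveFormFactor L x *ᵥ ψ) ⬝ᵥ (localPair dWaveFormFactor L y *ᵥ ψ)).re) /
                (L : ℝ) ^ 2) :
    ∃ L₀ : ℕ, ∀ (L : ℕ) [NeZero L], L₀ ≤ L → Even L →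
      ∀ ψ : Fock (Orb (FermionTorus 2 L)), star ψ ⬝ᵥ ψ = 1 →
        IsGroundStateInSector (hubbardTorus 2 L 1 U) (2 * ⌊(1 - δ) * (L : ℝ) ^ 2 / 2⌋₊) 0 ψ →
          c / (R : ℝ) ^ 2 ≤ (∑ x : TorusSite 2 L,
            (star (localPair dWaveFormFactor L x *ᵥ ψ) ⬝ᵥ (localPair dWaveFormFactor L x *ᵥ ψ)).re) /
              (L : ℝ) ^ 2 := by
  obtain ⟨L₀, hL⟩ := h
  refine ⟨max L₀ (2 * R), fun L _ hLge hEven ψ hψ hgs => ?_⟩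
  have hL0 : L₀ ≤ L := le_of_max_le_left hLge
  have h2R : 2 * R ≤ L := le_of_max_le_right hLge
  have hbody := hL L hL0 hEven ψ hψ hgs
  have hceil := boxSum_le_sq_mul_localWeight L R hR h2R ψ
  have hLpos : (0 : ℝ) < L := Nat.cast_pos.2 (Nat.pos_of_ne_zero (NeZero.ne L))
  have hL2 : (0 : ℝ) < (L : ℝ) ^ 2 := by positivity
  have hRpos : (0 : ℝ) < R := Nat.cast_pos.2 hR
  have hR2 : (0 : ℝ) < (R : ℝ) ^ 2 := by positivity
  set W : ℝ := ∑ x : TorusSite 2 L,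
      (star (localPair dWaveFormFactor L x *ᵥ ψ) ⬝ᵥ (localPair dWaveFormFactor L x *ᵥ ψ)).re with hW
  have key : c ≤ (R : ℝ) ^ 2 * W / (L : ℝ) ^ 2 :=
    hbody.trans (div_le_div_of_nonneg_right hceil hL2.le)
  rw [div_le_iff₀ hR2]
  calc c ≤ (R : ℝ) ^ 2 * W / (L : ℝ) ^ 2 := key
    _ = W / (L : ℝ) ^ 2 * (R : ℝ) ^ 2 := by ring

/-- Registered sub-goal form (line `redirect_birth`, lead c9, wave 1): the refuter instrument for stub (Q)
with all parameters explicit — nearly saturated sector ground states i.o. at `(U, δ)` refute the body of (Q)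
there at every scale `R ≥ 1` (`fluctuationFloorAt_false_of_nearlySaturated`). [folklore] -/
theorem fluctuationFloorAtFalseOfNearlySaturated : ∀ (U δ : ℝ), (∀ κ : ℝ, 0 < κ → ∃ᶠ L : ℕ in Filter.atTop, Even L ∧ ∃ (ψ : Fock (Orb (FermionTorus 2 L))) (S : ℕ), S ≤ ⌊(1 - δ) * (L : ℝ) ^ 2 / 2⌋₊ ∧ IsGroundStateInSector (hubbardTorus 2 L 1 U) (2 * ⌊(1 - δ) * (L : ℝ) ^ 2 / 2⌋₊) 0 ψ ∧ spinSq *ᵥ ψ = (((S : ℝ) * ((S : ℝ) + 1) : ℝ) : ℂ) • ψ ∧ ((⌊(1 - δ) * (L : ℝ) ^ 2 / 2⌋₊ - S : ℕ) : ℝ) ≤ κ * (L : ℝ) ^ 2) → ∀ R : ℕ, 0 < R → ¬ (∃ c : ℝ, 0 < c ∧ ∃ L₀ : ℕ, ∀ (L : ℕ) [NeZero L], L₀ ≤ L → Even L → ∀ ψ : Fock (Orb (FermionTorus 2 L)), star ψ ⬝ᵥ ψ = 1 → IsGroundStateInSector (hubbardTorus 2 L 1 U) (2 * ⌊(1 -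 δ) * (L : ℝ) ^ 2 / 2⌋₊) 0 ψ → c ≤ (∑ x : TorusSite 2 L, ∑ y : TorusSite 2 L, (∏ i : Fin 2, max 0 (1 - |(((y i - x i).valMinAbs : ℤ) : ℝ)| / (R : ℝ))) * (star (localPair dWaveFormFactor L x *ᵥ ψ) ⬝ᵥ (localPair dWaveFormFactor L y *ᵥ ψ)).re) / (L : ℝ) ^ 2) :=
  fun _ _ hns R hR => fluctuationFloorAt_false_of_nearlySaturated hns R hR

end Summit.HubbardSuperconductivity.HubbardSuperconductivity.Theorems.MesoscopicPairOrder.Negative
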